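import Summits.ResolutionOfSingularities.ResolutionOfSingularities.Theorems.WildASPairLU3
import HarnessLib

/-!
# WildASPairLU (4/5) — THE GENERIC UNIT CASE (pseudo-reflection) and THE ENGINE `asPair_collapse`

Node «ASPairCollapse» (decomp-res lens-1 g35), tree file 4/5.  With `t = x′_{j₂}/x′_{j₁}` on the AS-pair chart
`T⁺ = T[chartGens]` (file 2):
* `exists_pseudoReflection_of_generic` — if `t` is a unit with `t ≢ 1` (`v(t) = v(t − 1) = 1`) then `σ` is a
  PSEUDO-REFLECTION on `T⁺`: `σ b − b ∈ (σt − t)·T⁺_𝔪′` for all `b ∈ T⁺`, since `σ t − t = x′_{j₁}·t(1−t)(1+x′_{j₂})⁻¹`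
  with a UNIT cofactor, the augmentation of `B` lies in `(σx_i − x_i)_i ⊆ (x′_{j₁}, x′_{j₂}) = (x′_{j₁})` (Nakayama
  `exists_apply_sub_eq_sum`, `(1+e)^n − 1 ∈ e·B`), and the derivation rule runs along the generators.
* `asPair_collapse` — THE ENGINE (model level, hypothesis-free): an Artin–Schreier pair frame on a `σ`-stable regular
  model `T` produces a `σ`-stable regular model `T⁺ = T[s] ⊆ O` (`s` finite) of the same dimension carrying EITHER a
  `λ′`-frame (one principal unit `1 + x′_{j₁}`, monomial pivot; cases `v(t) < 1` via `t̃`-rescaling by `1 − t`, and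
  `t ≡ 1` via `t̂`-rescaling by `t`) OR a pseudo-reflection (`t` a generic unit): COCYCLE RANK DROPS `2 → ≤ 1` under ONE
  monoidal transform.
-/

noncomputable section

open IsLocalRing Literature.AlgebraicGeometry.Resolution
open Summit.ResolutionOfSingularities.ResolutionOfSingularities.Theorems.InvariantDescentLU
open Summit.ResolutionOfSingularities.ResolutionOfSingularities.Theorems.WildReflectionLU
open Summit.ResolutionOfSingularities.ResolutionOfSingularities.Theorems.WildLogDiagonalLU

universe u

namespace Summit.ResolutionOfSingularities.ResolutionOfSingularities.Theorems.WildASPairLU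

variable {E : Type u} [Field E]

/-- `σ t = t(1 + x′_{j₁})(1 + x′_{j₂})⁻¹` for `t = x′_{j₂}/x′_{j₁}` and an AS pair. [folklore] -/
theorem apply_ratio_eq {σ : E ≃+* E} {d : ℕ} {x' : Fin d → E} {j₁ j₂ : Fin d} {N₁ N₂ : Fin d → ℤ}
    (hN : N₁ j₁ = -1 ∧ N₂ j₁ = 0 ∧ N₁ j₂ = 0 ∧ N₂ j₂ = -1)
    (htw : ∀ j, σ (x' j) = x' j * (1 + x' j₁) ^ N₁ j * (1 + x' j₂) ^ N₂ j)
    (h0 : x' j₁ ≠ 0) (h1 : 1 + x' j₁ ≠ 0) (h2 : 1 + x' j₂ ≠ 0) :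
    σ (x' j₂ / x' j₁) = x' j₂ / x' j₁ * (1 + x' j₁) * (1 + x' j₂)⁻¹ := by
  obtain ⟨hN₁₁, hN₂₁, hN₁₂, hN₂₂⟩ := hN
  rw [map_div₀, htw j₁, htw j₂, hN₁₁, hN₂₁, hN₁₂, hN₂₂]
  simp only [zpow_zero, mul_one, zpow_neg, zpow_one]
  field_simp

section Engine

variable (O : ValuationSubring E) {S T : Subring E} {σ : E ≃+* E} (p : ℕ)

set_option maxHeartbeats 1600000 in
/-- **THE GENERIC UNIT CASE: a pseudo-reflection.**  On the AS-pair chart `T⁺ = T[chartGens] ⊆ O` (`σ`-stable), if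
`t = x′_{j₂}/x′_{j₁}` has `v(t) = 1 = v(t − 1)` then `y = t ∈ T⁺` is MOVED and `σ b − b ∈ (σ t − t)·T⁺_𝔪′` for every
`b ∈ T⁺` — the model-level block of the kind `WildPseudoReflectionLUAbove`.  (`σt − t = x′_{j₁}·[t(1−t)(1+x′_{j₂})⁻¹]`,
bracket a unit; augmentations of `B = T_𝔪′` by Nakayama `exists_apply_sub_eq_sum`; of `x′_j` by `(1+e₁)^a(1+e₂)^b − 1
∈ e₁B + e₂B` and `x′_{j₂} = t·x′_{j₁}`; derivation rule `apply_sub_mem_of_mem_closure`.)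
[cite: KiralyLutkebohmert2013, Thm. 2 (a), Rem. 3, pp. 64–65] -/
theorem exists_pseudoReflection_of_generic (hσO : ∀ z : E, z ∈ O ↔ σ z ∈ O)
    (hST : S ≤ T) (hσS : ∀ s ∈ S, σ s = s) (hTO : T ≤ O.toSubring) (hσT : ∀ z ∈ T, σ z ∈ T)
    (hreg : IsRegularLocalRing (locAtCentre T O)) (hres : ∀ y ∈ O, ∃ c ∈ S, O.valuation (y - c) < 1)
    {d : ℕ} {x x' : Fin d → E} {A : Fin d → Fin d → ℕ} {j₁ j₂ : Fin d} {N₁ N₂ : Fin d → ℤ}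
    (hx : ∀ i, x i ∈ locAtCentre T O ∧ O.valuation (x i) < 1)
    (hgen : ∀ b ∈ locAtCentre T O, O.valuation b < 1 →
      ∃ c : Fin d → E, (∀ i, c i ∈ locAtCentre T O) ∧ b = ∑ i, c i * x i)
    (hx' : ∀ j, x' j ≠ 0 ∧ x' j ∈ O ∧ O.valuation (x' j) < 1 ∧ ∃ a b : E, a ∈ T ∧ b ∈ T ∧ x' j = a / b)
    (hmon : ∀ i, x i = ∏ j, x' j ^ A i j) (hx'T : x' j₁ ∈ T ∧ x' j₂ ∈ T)
    (hN : N₁ j₁ = -1 ∧ N₂ j₁ = 0 ∧ N₁ j₂ = 0 ∧ N₂ j₂ = -1)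
    (htw : ∀ j, σ (x' j) = x' j * (1 + x' j₁) ^ N₁ j * (1 + x' j₂) ^ N₂ j)
    {T' : Subring E} (hT' : T' = Subring.closure ((T : Set E) ∪ chartGens σ p x' j₁ j₂))
    (hT'O : T' ≤ O.toSubring) (hσT' : ∀ z ∈ T', σ z ∈ T')
    (hvt : O.valuation (x' j₂ / x' j₁) = 1) (hvt1 : O.valuation (x' j₂ / x' j₁ - 1) = 1) :
    ∃ y ∈ T', σ y ≠ y ∧ ∀ b ∈ T', ∃ c ∈ locAtCentre T' O, σ b - b = (σ y - y) * c := by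
  classical
  subst hT'
  set t : E := x' j₂ / x' j₁ with htdef
  set z₁ : Fin p → E := fun i => (1 + (σ ^ (i : ℕ)) (x' j₁))⁻¹ with hz₁def
  set z₂ : Fin p → E := fun i => (1 + (σ ^ (i : ℕ)) (x' j₂))⁻¹ with hz₂def
  have hgens : chartGens σ p x' j₁ j₂ = Set.range x' ∪ (Set.range z₁ ∪ Set.range z₂) ∪ {t} := rfl
  rw [hgens] at hT'O hσT' ⊢
  set T' : Subring E := Subring.closure ((T : Set E) ∪ (Set.range x' ∪ (Set.range z₁ ∪ Set.range z₂) ∪ {t}))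
    with hT'def
  set B : Subring E := locAtCentre T O with hBdef
  haveI : IsLocalRing B := isLocalRing_locAtCentre hTO
  haveI := hreg
  haveI : IsNoetherianRing B := inferInstance
  have hBO : B ≤ O.toSubring := locAtCentre_le hTO
  have hTB : T ≤ B := le_locAtCentre T O
  set B' : Subring E := locAtCentre T' O with hB'def
  have hTT' : T ≤ T' := fun b hb => Subring.subset_closure (Or.inl hb)
  have hBB' : B ≤ B' := locAtCentre_mono O hTT'
  have hT'B' : T' ≤ B' := le_locAtCentre T' O
  have hσB' : ∀ b ∈ B', σ b ∈ B' := fun b hb => apply_mem_locAtCentre O hσO hσT' hb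
  have hx0 : ∀ j, x' j ≠ 0 := fun j => (hx' j).1
  have hx'T' : ∀ j, x' j ∈ T' := fun j => Subring.subset_closure (Or.inr (Or.inl (Or.inl ⟨j, rfl⟩)))
  have htT' : t ∈ T' := Subring.subset_closure (Or.inr (Or.inr rfl))
  -- the adjoined inverses lie in `B`
  have hσiO : ∀ (i : ℕ) (b : E), b ∈ O ↔ (σ ^ i) b ∈ O := mem_iff_pow_apply_mem O hσO
  have hσiT : ∀ (i : ℕ) {b : E}, b ∈ T → (σ ^ i) b ∈ T := fun i b hb => pow_apply_mem_of_stable hσT i hb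
  have h1i : ∀ (i : ℕ) (j : Fin d), O.valuation (1 + (σ ^ i) (x' j)) = 1 := fun i j =>
    valuation_one_add_eq_one O (valuation_apply_lt_one O (hσiO i) (hx' j).2.2.1)
  have hz₁B : ∀ i, z₁ i ∈ B := fun i =>
    inv_mem_locAtCentre (hTB (T.add_mem T.one_mem (hσiT i hx'T.1))) (h1i i j₁)
  have hz₂B : ∀ i, z₂ i ∈ B := fun i =>
    inv_mem_locAtCentre (hTB (T.add_mem T.one_mem (hσiT i hx'T.2))) (h1i i j₂)
  -- units: `1 + x′_{j_k}`, `t`, `1 − t`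
  have hU1v : O.valuation (1 + x' j₁) = 1 := valuation_one_add_eq_one O (hx' j₁).2.2.1
  have hU2v : O.valuation (1 + x' j₂) = 1 := valuation_one_add_eq_one O (hx' j₂).2.2.1
  have hU10 : (1 + x' j₁) ≠ 0 := ne_zero_of_valuation_eq_one hU1v
  have hU20 : (1 + x' j₂) ≠ 0 := ne_zero_of_valuation_eq_one hU2v
  have ht0 : t ≠ 0 := ne_zero_of_valuation_eq_one hvt
  have h1t : O.valuation (1 - t) = 1 := by rw [← neg_sub, Valuation.map_neg]; exact hvt1
  have h1t0 : (1 - t) ≠ 0 := ne_zero_of_valuation_eq_one h1t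
  have hx2 : x' j₂ = t * x' j₁ := by rw [htdef, div_mul_cancel₀ _ (hx0 j₁)]
  have hU1B' : 1 + x' j₁ ∈ B' := B'.add_mem B'.one_mem (hT'B' (hx'T' j₁))
  have hU2B' : 1 + x' j₂ ∈ B' := B'.add_mem B'.one_mem (hT'B' (hx'T' j₂))
  have hU1inv : (1 + x' j₁)⁻¹ ∈ B' := inv_mem_locAtCentre hU1B' hU1v
  have hU2inv : (1 + x' j₂)⁻¹ ∈ B' := inv_mem_locAtCentre hU2B' hU2v
  have htB' : t ∈ B' := hT'B' htT'
  have htinv : t⁻¹ ∈ B' := inv_mem_locAtCentre htB' hvt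
  have h1tinv : (1 - t)⁻¹ ∈ B' := inv_mem_locAtCentre (B'.sub_mem B'.one_mem htB') h1t
  -- `δ = σ t − t = x′_{j₁}·t(1−t)(1+x′_{j₂})⁻¹`
  have hσt : σ t = t * (1 + x' j₁) * (1 + x' j₂)⁻¹ := apply_ratio_eq hN htw (hx0 j₁) hU10 hU20
  set δ : E := σ t - t with hδ
  have hδeq : δ = x' j₁ * (t * (1 - t) * (1 + x' j₂)⁻¹) := by
    have h2 : 1 + t * x' j₁ ≠ 0 := by rw [← hx2]; exact hU20
    have h := toy_apply_ratio_sub (x₁ := x' j₁) (t := t) h2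
    rw [← hx2] at h
    rw [hδ, hσt, h]
  have hδ0 : δ ≠ 0 := by
    rw [hδeq]
    exact mul_ne_zero (hx0 j₁) (mul_ne_zero (mul_ne_zero ht0 h1t0) (inv_ne_zero hU20))
  have hx1δ : x' j₁ = δ * ((1 + x' j₂) * (t⁻¹ * (1 - t)⁻¹)) := by
    rw [hδeq]
    field_simp
  have hcoB' : (1 + x' j₂) * (t⁻¹ * (1 - t)⁻¹) ∈ B' := B'.mul_mem hU2B' (B'.mul_mem htinv h1tinv)
  -- the frame coordinates: `σ x′_j − x′_j = x′_j·((1+x′_{j₁})^{N₁ j}(1+x′_{j₂})^{N₂ j} − 1) ∈ x′_{j₁} B′ = δ B′`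
  have hPx' : ∀ j, x' j ∈ B' ∧ ∃ c ∈ B', σ (x' j) - x' j = δ * c := fun j => by
    obtain ⟨c₁, hc₁, c₂, hc₂, e⟩ := exists_zpow_mul_zpow_sub_one_eq B' (hT'B' (hx'T' j₁)) hU1inv
      (hT'B' (hx'T' j₂)) hU2inv (N₁ j) (N₂ j)
    refine ⟨hT'B' (hx'T' j), x' j * (c₁ + t * c₂) * ((1 + x' j₂) * (t⁻¹ * (1 - t)⁻¹)),
      B'.mul_mem (B'.mul_mem (hT'B' (hx'T' j)) (B'.add_mem hc₁ (B'.mul_mem htB' hc₂))) hcoB', ?_⟩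
    calc σ (x' j) - x' j = x' j * ((1 + x' j₁) ^ N₁ j * (1 + x' j₂) ^ N₂ j - 1) := by rw [htw j]; ring
      _ = x' j * (x' j₁ * c₁ + x' j₂ * c₂) := by rw [e]
      _ = x' j * (x' j₁ * (c₁ + t * c₂)) := by rw [hx2]; ring
      _ = δ * (x' j * (c₁ + t * c₂) * ((1 + x' j₂) * (t⁻¹ * (1 - t)⁻¹))) := by rw [hx1δ]; ring
  -- the monomials `x_i`, then all of `B` by Nakayama, then `T⁺` by the derivation rule
  have hPx : ∀ i, x i ∈ B' ∧ ∃ c ∈ B', σ (x i) - x i = δ * c := fun i => by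
    have hxi : x i ∈ Subring.closure (Set.range x') := by
      rw [hmon i]
      exact Subring.prod_mem _ fun j _ =>
        Subring.pow_mem _ (Subring.subset_closure (Set.mem_range_self j)) _
    exact apply_sub_mem_of_mem_closure hσB' δ (by rintro _ ⟨j, rfl⟩; exact hPx' j) hxi
  have hresB : ∀ b ∈ B, ∃ c ∈ B, σ c = c ∧ O.valuation (b - c) < 1 := fun b hb => by
    obtain ⟨c, hcS, hvc⟩ := hres b (hBO hb)
    exact ⟨c, hTB (hST hcS), hσS c hcS, hvc⟩
  choose e' he' he'e using fun i => (hPx i).2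
  have hPB : ∀ b ∈ B, b ∈ B' ∧ ∃ c ∈ B', σ b - b = δ * c := by
    intro b hb
    obtain ⟨c, hc, e⟩ := exists_apply_sub_eq_sum O hTO hσO hσT hresB hx hgen hb
    refine ⟨hBB' hb, ∑ i, c i * e' i, B'.sum_mem fun i _ => B'.mul_mem (hBB' (hc i)) (he' i), ?_⟩
    rw [e, Finset.mul_sum]
    exact Finset.sum_congr rfl fun i _ => by rw [he'e i]; ring
  have hPT' : ∀ b ∈ T', b ∈ B' ∧ ∃ c ∈ B', σ b - b = δ * c := fun b hb =>
    apply_sub_mem_of_mem_closure hσB' δ (by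
      rintro b (hb | ((⟨j, rfl⟩ | (⟨i, rfl⟩ | ⟨i, rfl⟩)) | hb))
      · exact hPB b (hTB hb)
      · exact hPx' j
      · exact hPB _ (hz₁B i)
      · exact hPB _ (hz₂B i)
      · rw [Set.mem_singleton_iff.mp hb]
        exact ⟨htB', 1, B'.one_mem, by rw [mul_one]⟩) hb
  refine ⟨t, htT', fun e => hδ0 ?_, fun b hb => (hPT' b hb).2⟩
  rw [hδ, e, sub_self]

/-- **THE ENGINE'S OUTPUT** (tag: DATA — a named conjunction, not a kind) on a model `T⁺ ⊆ O` of dimension `d`: `T⁺ ⊆ O`, `σ`-stable, regular at the centre, and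
EITHER the model-level block of `λ′ = WildLogDiagonalUnluckyAbove` (frame `x = x′^A` generating the centre, MONOMIAL
pivot `η = w·∏ x′^{a′} ∈ T⁺`, ONE principal unit: `σ x′_j = x′_j (1 + η)^{N j}`, some `N j ≠ 0`) OR the model-level
block of `WildPseudoReflectionLUAbove` (a moved `y ∈ T⁺` whose augmentation generates). [this node] -/
def CollapseData (O : ValuationSubring E) (σ : E ≃+* E) (T' : Subring E) (d : ℕ) : Prop :=
  T' ≤ O.toSubring ∧ (∀ z ∈ T', σ z ∈ T') ∧ IsRegularLocalRing (locAtCentre T' O) ∧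
    ((∃ x x' : Fin d → E, ∃ A : Fin d → Fin d → ℕ, ∃ η w : E, ∃ a' : Fin d → ℕ, ∃ N : Fin d → ℤ,
        ringKrullDim (locAtCentre T' O) = d ∧
        (∀ i, x i ∈ locAtCentre T' O ∧ O.valuation (x i) < 1) ∧
        (∀ b ∈ locAtCentre T' O, O.valuation b < 1 →
          ∃ c : Fin d → E, (∀ i, c i ∈ locAtCentre T' O) ∧ b = ∑ i, c i * x i) ∧
        (∀ j, x' j ≠ 0 ∧ x' j ∈ O ∧ O.valuation (x' j) < 1 ∧ ∃ a b : E, a ∈ T' ∧ b ∈ T' ∧ x' j = a / b) ∧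
        (∀ i, x i = ∏ j, x' j ^ A i j) ∧
        (η ∈ T' ∧ O.valuation η < 1 ∧ w ∈ locAtCentre T' O ∧ O.valuation w = 1 ∧ η = w * ∏ j, x' j ^ a' j) ∧
        (∀ j, σ (x' j) = x' j * (1 + η) ^ N j) ∧ ∃ j, N j ≠ 0) ∨
      (∃ y ∈ T', σ y ≠ y ∧ ∀ b ∈ T', ∃ c ∈ locAtCentre T' O, σ b - b = (σ y - y) * c))

variable [hp : Fact p.Prime]

set_option maxHeartbeats 1600000 in
/-- **THE ENGINE, labelled case `v(x′_{j₂}) ≤ v(x′_{j₁})`** — the TRICHOTOMY on `t = x′_{j₂}/x′_{j₁} ∈ T⁺`: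
(i) `v(t) < 1`: the frame `x′[j₂ ↦ t]` generates (file 2) and the unit `c = 1 − t` (`σ c = c(1+x′_{j₂})⁻¹`) rescales it
to a `λ′`-frame with pivot `x′_{j₁}` (file 3; `t ↦ t̃ = t/(1−t)`); (ii) `v(t) = 1`, `v(t−1) < 1`: the frame `x′[j₂ ↦ t − 1]`
generates (file 3) and the unit `c = t` (`σ t = t(1+x′_{j₁})(1+x′_{j₂})⁻¹`) rescales it (`t − 1 ↦ t̂ = (t−1)/t`);
(iii) `v(t) = v(t−1) = 1`: pseudo-reflection (this file). [this node] -/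
theorem asPair_collapse_of_le (hσO : ∀ z : E, z ∈ O ↔ σ z ∈ O) (hσp : σ ^ p = 1)
    (hST : S ≤ T) (hσS : ∀ s ∈ S, σ s = s) (hTO : T ≤ O.toSubring) (hσT : ∀ z ∈ T, σ z ∈ T)
    (hreg : IsRegularLocalRing (locAtCentre T O)) (hTuc : IsUniversallyCatenaryRing (locAtCentre T O))
    (hres : ∀ y ∈ O, ∃ c ∈ S, O.valuation (y - c) < 1)
    {d : ℕ} {x x' : Fin d → E} {A : Fin d → Fin d → ℕ} {j₁ j₂ : Fin d} {N₁ N₂ : Fin d → ℤ}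
    (hdim : ringKrullDim (locAtCentre T O) = d)
    (hx : ∀ i, x i ∈ locAtCentre T O ∧ O.valuation (x i) < 1)
    (hgen : ∀ b ∈ locAtCentre T O, O.valuation b < 1 →
      ∃ c : Fin d → E, (∀ i, c i ∈ locAtCentre T O) ∧ b = ∑ i, c i * x i)
    (hx' : ∀ j, x' j ≠ 0 ∧ x' j ∈ O ∧ O.valuation (x' j) < 1 ∧ ∃ a b : E, a ∈ T ∧ b ∈ T ∧ x' j = a / b)
    (hmon : ∀ i, x i = ∏ j, x' j ^ A i j) (h12 : x' j₁ ≠ x' j₂) (hx'T : x' j₁ ∈ T ∧ x' j₂ ∈ T)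
    (hN : N₁ j₁ = -1 ∧ N₂ j₁ = 0 ∧ N₁ j₂ = 0 ∧ N₂ j₂ = -1)
    (htw : ∀ j, σ (x' j) = x' j * (1 + x' j₁) ^ N₁ j * (1 + x' j₂) ^ N₂ j)
    (hle : O.valuation (x' j₂) ≤ O.valuation (x' j₁)) :
    ∃ s : Set E, s.Finite ∧ CollapseData O σ (Subring.closure ((T : Set E) ∪ s)) d := by
  classical
  have hj : j₁ ≠ j₂ := fun h => h12 (by rw [h])
  obtain ⟨hT'O, hσT', hreg', hdim', hE1, hmB, hgen1⟩ :=
    asChart O p hσO hσp hST hTO hσT hreg hTuc hres hdim hx hgen hx' hmon hj hx'T hN htw hle _ rfl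
  refine ⟨chartGens σ p x' j₁ j₂, chartGens_finite σ p x' j₁ j₂, hT'O, hσT', hreg', ?_⟩
  set T' : Subring E := Subring.closure ((T : Set E) ∪ chartGens σ p x' j₁ j₂) with hT'def
  set B : Subring E := locAtCentre T O with hBdef
  have hBO : B ≤ O.toSubring := locAtCentre_le hTO
  obtain ⟨hN₁₁, hN₂₁, hN₁₂, hN₂₂⟩ := hN
  set t : E := x' j₂ / x' j₁ with htdef
  have hx0 : ∀ j, x' j ≠ 0 := fun j => (hx' j).1
  have hx'T' : ∀ j, x' j ∈ T' := fun j => Subring.subset_closure (Or.inr (Or.inl (Or.inl ⟨j, rfl⟩)))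
  have htT' : t ∈ T' := Subring.subset_closure (Or.inr (Or.inr rfl))
  have htO : t ∈ O := hT'O htT'
  have hU1v : O.valuation (1 + x' j₁) = 1 := valuation_one_add_eq_one O (hx' j₁).2.2.1
  have hU2v : O.valuation (1 + x' j₂) = 1 := valuation_one_add_eq_one O (hx' j₂).2.2.1
  have hU10 : (1 + x' j₁) ≠ 0 := ne_zero_of_valuation_eq_one hU1v
  have hU20 : (1 + x' j₂) ≠ 0 := ne_zero_of_valuation_eq_one hU2v
  have ht0 : t ≠ 0 := div_ne_zero (hx0 j₂) (hx0 j₁)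
  have ht1 : t - 1 ≠ 0 := fun h => h12 (by
    have e : t = 1 := sub_eq_zero.mp h
    rw [htdef, div_eq_one_iff_eq (hx0 j₁)] at e
    exact e.symm)
  have hx2 : x' j₂ = t * x' j₁ := by rw [htdef, div_mul_cancel₀ _ (hx0 j₁)]
  have h2' : 1 + t * x' j₁ ≠ 0 := by rw [← hx2]; exact hU20
  have hσt : σ t = t * (1 + x' j₁) * (1 + x' j₂)⁻¹ :=
    apply_ratio_eq ⟨hN₁₁, hN₂₁, hN₁₂, hN₂₂⟩ htw (hx0 j₁) hU10 hU20
  -- the frame `y = x′[j₂ ↦ t]`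
  set y : Fin d → E := Function.update x' j₂ t with hydef
  have hyj₂ : y j₂ = t := Function.update_self j₂ t x'
  have hyne : ∀ j, j ≠ j₂ → y j = x' j := fun j h => Function.update_of_ne h t x'
  have hyj₁ : y j₁ = x' j₁ := hyne j₁ hj
  have hyT' : ∀ j, y j ∈ T' := fun j => by
    by_cases h : j = j₂
    · rw [h, hyj₂]; exact htT'
    · rw [hyne j h]; exact hx'T' j
  have hyO : ∀ j, y j ∈ O := fun j => hT'O (hyT' j)
  have hy0 : ∀ j, y j ≠ 0 := fun j => by
    by_cases h : j = j₂
    · rw [h, hyj₂]; exact ht0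
    · rw [hyne j h]; exact hx0 j
  have hQ : Function.update N₂ j₂ (-1) j₁ = 0 := by rw [Function.update_of_ne hj]; exact hN₂₁
  rcases lt_or_eq_of_le ((O.valuation_le_one_iff t).mpr htO) with hvt | hvt
  · -- CASE (i): `v(t) < 1` — rescale the frame `y` by the unit `1 − t`
    left
    have hyv : ∀ j, O.valuation (y j) < 1 := fun j => by
      by_cases h : j = j₂
      · rw [h, hyj₂]; exact hvt
      · rw [hyne j h]; exact (hx' j).2.2.1
    have h1tv : O.valuation (1 - t) = 1 := by
      rw [sub_eq_add_neg]
      exact valuation_one_add_eq_one O (by rw [Valuation.map_neg]; exact hvt)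
    have h1tT' : 1 - t ∈ T' := T'.sub_mem T'.one_mem htT'
    have hσc : σ (1 - t) = (1 - t) * (1 + y j₁) ^ (0 : ℤ) * (1 + x' j₂)⁻¹ := by
      rw [map_sub, map_one, hσt, zpow_zero, mul_one, hx2]
      exact toy_one_sub_apply_ratio h2'
    have htwy : ∀ j, σ (y j) = y j * (1 + y j₁) ^ Function.update N₁ j₂ 1 j *
        (1 + x' j₂) ^ Function.update N₂ j₂ (-1) j := by
      intro j
      by_cases h : j = j₂
      · rw [h, hyj₂, hyj₁, Function.update_self, Function.update_self, hσt, zpow_one, zpow_neg, zpow_one]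
      · rw [hyne j h, hyj₁, Function.update_of_ne h, Function.update_of_ne h]
        exact htw j
    have hne : ∃ j, Function.update N₁ j₂ 1 j + 0 * Function.update N₂ j₂ (-1) j ≠ 0 :=
      ⟨j₁, by rw [zero_mul, add_zero, Function.update_of_ne hj, hN₁₁]; norm_num⟩
    exact exists_logDiagonal_frame_of_rescale O hT'O hyT' hy0 hyv (hgen1 hvt) hdim' hU2v h1tT' h1tv hσc htwy
      hQ hne
  rcases lt_or_eq_of_le ((O.valuation_le_one_iff (t - 1)).mpr (O.toSubring.sub_mem htO O.toSubring.one_mem))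
    with hvt1 | hvt1
  · -- CASE (ii): `t ≡ 1` — the frame `ŷ = x′[j₂ ↦ t − 1]` generates; rescale it by the unit `t`
    left
    set w : Fin d → E := Function.update x' j₂ (t - 1) with hwdef
    have hwj₂ : w j₂ = t - 1 := Function.update_self j₂ (t - 1) x'
    have hwne : ∀ j, j ≠ j₂ → w j = x' j := fun j h => Function.update_of_ne h (t - 1) x'
    have hwj₁ : w j₁ = x' j₁ := hwne j₁ hj
    have ht1T' : t - 1 ∈ T' := T'.sub_mem htT' T'.one_mem
    have hwT' : ∀ j, w j ∈ T' := fun j => by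
      by_cases h : j = j₂
      · rw [h, hwj₂]; exact ht1T'
      · rw [hwne j h]; exact hx'T' j
    have hw0 : ∀ j, w j ≠ 0 := fun j => by
      by_cases h : j = j₂
      · rw [h, hwj₂]; exact ht1
      · rw [hwne j h]; exact hx0 j
    have hwv : ∀ j, O.valuation (w j) < 1 := fun j => by
      by_cases h : j = j₂
      · rw [h, hwj₂]; exact hvt1
      · rw [hwne j h]; exact (hx' j).2.2.1
    have hgenw : ∀ b ∈ locAtCentre T' O, O.valuation b < 1 →
        ∃ c : Fin d → E, (∀ j, c j ∈ locAtCentre T' O) ∧ b = ∑ j, c j * w j := by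
      intro b hb hbv
      rw [hE1] at hb
      have hlt : ∀ j, j ≠ j₂ → O.valuation (y j) < 1 := fun j h => by rw [hyne j h]; exact (hx' j).2.2.1
      have hunit : O.valuation (y j₂) = 1 := by rw [hyj₂]; exact hvt
      have hone : O.valuation (y j₂ - 1) < 1 := by rw [hyj₂]; exact hvt1
      obtain ⟨c, hc, hbeq⟩ := exists_sum_mul_update_sub_one O hBO hyO hlt hunit hone hmB hb hbv
      refine ⟨c, fun j => by rw [hE1]; exact hc j, ?_⟩
      rw [hbeq]
      refine Finset.sum_congr rfl fun j _ => ?_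
      rw [hyj₂, hydef, Function.update_idem]
    have hσc : σ t = t * (1 + w j₁) ^ (1 : ℤ) * (1 + x' j₂)⁻¹ := by rw [hwj₁, zpow_one]; exact hσt
    have htwy : ∀ j, σ (w j) = w j * (1 + w j₁) ^ Function.update N₁ j₂ 0 j *
        (1 + x' j₂) ^ Function.update N₂ j₂ (-1) j := by
      intro j
      by_cases h : j = j₂
      · rw [h, hwj₂, hwj₁, Function.update_self, Function.update_self, map_sub, map_one, hσt, zpow_zero, mul_one,
          zpow_neg, zpow_one, hx2]
        exact toy_apply_ratio_sub_one h2'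
      · rw [hwne j h, hwj₁, Function.update_of_ne h, Function.update_of_ne h]
        exact htw j
    have hne : ∃ j, Function.update N₁ j₂ 0 j + 1 * Function.update N₂ j₂ (-1) j ≠ 0 :=
      ⟨j₂, by rw [Function.update_self, Function.update_self]; norm_num⟩
    exact exists_logDiagonal_frame_of_rescale O hT'O hwT' hw0 hwv hgenw hdim' hU2v htT' hvt hσc htwy hQ hne
  · -- CASE (iii): `t` a generic unit — pseudo-reflection
    right
    exact exists_pseudoReflection_of_generic O p hσO hST hσS hTO hσT hreg hres hx hgen hx' hmon hx'T
      ⟨hN₁₁, hN₂₁, hN₁₂, hN₂₂⟩ htw rfl hT'O hσT' hvt hvt1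

set_option maxHeartbeats 800000 in
/-- **THE ENGINE `asPair_collapse` (model level, hypothesis-free).**  A `σ`-stable regular `d`-dimensional model `T`
(`S ⊆ T` fixed with residues in `S`, `T_𝔪′` universally catenary) carrying an ARTIN–SCHREIER PAIR FRAME — monomials
`x = x′^A` generating the centre, distinct pivots `x′_{j₁} ≠ x′_{j₂}` in `T` with `σ x′_j = x′_j(1+x′_{j₁})^{N₁ j}(1+x′_{j₂})^{N₂ j}`,
`N₁ j₁ = N₂ j₂ = −1`, `N₂ j₁ = N₁ j₂ = 0` — carries a finite set `s ⊆ O` such that `T⁺ = T[s]` is `σ`-stable, regular of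
dimension `d` at the centre of `O`, and carries a `λ′`-FRAME or a PSEUDO-REFLECTION (`CollapseData`): the cocycle rank
drops from `2` to `≤ 1` after ONE monoidal transform of `(x′_{j₁}, x′_{j₂})` (labels swapped when `v(x′_{j₁}) < v(x′_{j₂})`).
USED: `σ^p = 1`, the frame clauses, the AS-pair clause; NOT used: `p = char`, any rank / independence clause.
[this node; cites: KiralyLutkebohmert2013 Thm. 2, Ex. 6, Rem. 3; CossartPiltant2008 Prop. 8.1, Lemma 9.4] -/
theorem asPair_collapse (hσO : ∀ z : E, z ∈ O ↔ σ z ∈ O) (hσp : σ ^ p = 1)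
    (hST : S ≤ T) (hσS : ∀ s ∈ S, σ s = s) (hTO : T ≤ O.toSubring) (hσT : ∀ z ∈ T, σ z ∈ T)
    (hreg : IsRegularLocalRing (locAtCentre T O)) (hTuc : IsUniversallyCatenaryRing (locAtCentre T O))
    (hres : ∀ y ∈ O, ∃ c ∈ S, O.valuation (y - c) < 1)
    {d : ℕ} {x x' : Fin d → E} {A : Fin d → Fin d → ℕ} {j₁ j₂ : Fin d} {N₁ N₂ : Fin d → ℤ}
    (hdim : ringKrullDim (locAtCentre T O) = d)
    (hx : ∀ i, x i ∈ locAtCentre T O ∧ O.valuation (x i) < 1)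
    (hgen : ∀ b ∈ locAtCentre T O, O.valuation b < 1 →
      ∃ c : Fin d → E, (∀ i, c i ∈ locAtCentre T O) ∧ b = ∑ i, c i * x i)
    (hx' : ∀ j, x' j ≠ 0 ∧ x' j ∈ O ∧ O.valuation (x' j) < 1 ∧ ∃ a b : E, a ∈ T ∧ b ∈ T ∧ x' j = a / b)
    (hmon : ∀ i, x i = ∏ j, x' j ^ A i j) (h12 : x' j₁ ≠ x' j₂) (hx'T : x' j₁ ∈ T ∧ x' j₂ ∈ T)
    (hN : N₁ j₁ = -1 ∧ N₂ j₁ = 0 ∧ N₁ j₂ = 0 ∧ N₂ j₂ = -1)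
    (htw : ∀ j, σ (x' j) = x' j * (1 + x' j₁) ^ N₁ j * (1 + x' j₂) ^ N₂ j) :
    ∃ s : Set E, s.Finite ∧ CollapseData O σ (Subring.closure ((T : Set E) ∪ s)) d := by
  rcases le_total (O.valuation (x' j₂)) (O.valuation (x' j₁)) with hle | hle
  · exact asPair_collapse_of_le O p hσO hσp hST hσS hTO hσT hreg hTuc hres hdim hx hgen hx' hmon h12 hx'T hN htw hle
  · obtain ⟨hN₁₁, hN₂₁, hN₁₂, hN₂₂⟩ := hN
    exact asPair_collapse_of_le O p hσO hσp hST hσS hTO hσT hreg hTuc hres hdim hx hgen hx' hmon (Ne.symm h12)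
      hx'T.symm ⟨hN₂₂, hN₁₂, hN₂₁, hN₁₁⟩ (fun j => by rw [htw j, mul_right_comm]) hle

end Engine

end Summit.ResolutionOfSingularities.ResolutionOfSingularities.Theorems.WildASPairLU

end
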